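import Literature.NumberTheory.LFunctions.PrimeIdealTheoremProofs
import Literature.NumberTheory.LFunctions.LogIntegralOffsetProofs
import Literature.NumberTheory.LFunctions.PrimeIdealCountRat
import HarnessLib

/-!
# `π_K(x) ∼ π(x)`: every number field has asymptotically as many prime ideals as `ℚ`

Topic `Literature/NumberTheory/LFunctions`; namespace `Literature.NumberTheory.LFunctions.NumberField`
(that of `PrimeIdealTheorem.lean`).  Everything in this file is PROVED (theorems only, nothing is
defined, no named fact).

From the tree's **theorems** `primeIdealTheorem_holds` (Landau's prime ideal theorem with
de la Vallée-Poussin error term, `|π_K(x) − Li(x)| ≤ C_K x e^{−c_K √log x}`, unconditionally, for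
every number field `K : Type`), `isEquivalent_offsetLogIntegral_holds` (`Li(x) ∼ x / log x`) and
`primeIdealCount_rat` (`π_ℚ(x) = π(⌊x⌋)`) we derive the qualitative consequences

* `isLittleO_mul_exp_neg_sqrt_log` — `x e^{−c√log x} = o(x / log x)` for `c > 0`;
* `isEquivalent_primeIdealCount_offsetLogIntegral`, `isEquivalent_primeIdealCount` —
  `π_K(x) ∼ Li(x) ∼ x / log x` (Landau 1903, "Primidealsatz");
* `tendsto_primeIdealCount_div_primeIdealCount_rat`, `tendsto_primeIdealCount_div_primeCounting` —
  **`π_K(x) / π(x) → 1`** (over real `x → ∞`, resp. over natural `n → ∞` with Mathlib's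
  `Nat.primeCounting`), the form in which the prime ideal theorem yields natural densities of
  sets of rational primes defined by splitting conditions (used for the density of supersingular
  primes, `EllipticCurves/SupersingularDensity*`).

## References

* E. Landau, *Neuer Beweis des Primzahlsatzes und Beweis des Primidealsatzes*, Math. Ann. 56
  (1903), 645–670 (`LandauMathAnn1903`).
* H. L. Montgomery, R. C. Vaughan, *Multiplicative Number Theory I*, CUP 2007, Thm. 8.9,
  pp. 266–268 (`MontgomeryVaughan2007`).
-/

noncomputable section

open Filter Asymptotics Real
open scoped Topology NumberField

namespace Literature.NumberTheory.LFunctions.NumberField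

/-- `log x · e^{−c √log x} → 0` as `x → ∞` (`c > 0`): with `u = √log x → ∞` this is
`u² e^{−cu} → 0`. [folklore] -/
theorem tendsto_log_mul_exp_neg_sqrt_log {c : ℝ} (hc : 0 < c) :
    Tendsto (fun x : ℝ ↦ Real.log x * Real.exp (-c * Real.sqrt (Real.log x))) atTop (𝓝 0) := by
  -- `u ↦ u² e^{-c u}` tends to `0`
  have h1 : Tendsto (fun u : ℝ ↦ u ^ 2 * Real.exp (-(c * u))) atTop (𝓝 0) := by
    have h := (tendsto_pow_mul_exp_neg_atTop_nhds_zero 2).comp (tendsto_id.const_mul_atTop hc)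
    have h' : Tendsto (fun u : ℝ ↦ (1 / c ^ 2) * ((c * u) ^ 2 * Real.exp (-(c * u)))) atTop
        (𝓝 ((1 / c ^ 2) * 0)) := h.const_mul _
    rw [mul_zero] at h'
    refine h'.congr fun u ↦ ?_
    field_simp
  -- compose with `x ↦ √log x → ∞`
  have h2 : Tendsto (fun x : ℝ ↦ Real.sqrt (Real.log x)) atTop atTop :=
    tendsto_sqrt_atTop.comp tendsto_log_atTop
  have h3 := h1.comp h2
  refine (h3.congr' ?_)
  filter_upwards [eventually_ge_atTop (1 : ℝ)] with x hx
  simp only [Function.comp_apply]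
  rw [Real.sq_sqrt (Real.log_nonneg hx), neg_mul]

/-- **`x e^{−c√log x} = o(x / log x)`** for `c > 0`: de la Vallée-Poussin's error term is
negligible against the main term. [folklore] -/
theorem isLittleO_mul_exp_neg_sqrt_log {c : ℝ} (hc : 0 < c) :
    (fun x : ℝ ↦ x * Real.exp (-c * Real.sqrt (Real.log x))) =o[atTop]
      fun x : ℝ ↦ x / Real.log x := by
  refine (isLittleO_iff_tendsto' ?_).mpr ?_
  · filter_upwards [eventually_gt_atTop (1 : ℝ)] with x hx h
    exfalso
    exact (div_pos (by linarith) (Real.log_pos hx)).ne' h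
  · refine (tendsto_log_mul_exp_neg_sqrt_log hc).congr' ?_
    filter_upwards [eventually_gt_atTop (1 : ℝ)] with x hx
    have hx0 : x ≠ 0 := by positivity
    have hl : Real.log x ≠ 0 := (Real.log_pos hx).ne'
    field_simp

/-- **`π_K(x) ∼ Li(x)`** (the prime ideal theorem, qualitative form; Landau 1903): from the
tree's theorem `primeIdealTheorem_holds` and `x e^{−c√log x} = o(x/log x) = o(Li x)`.
[cite: LandauMathAnn1903, Primidealsatz] -/
theorem isEquivalent_primeIdealCount_offsetLogIntegral (K : Type) [Field K] [NumberField K] :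
    (fun x : ℝ ↦ (primeIdealCount K x : ℝ)) ~[atTop] offsetLogIntegral := by
  obtain ⟨c, hc, C, hC⟩ := primeIdealTheorem_holds K
  -- `π_K − Li = O(x e^{-c√log x})`
  have hO : (fun x : ℝ ↦ (primeIdealCount K x : ℝ) - offsetLogIntegral x) =O[atTop]
      fun x : ℝ ↦ x * Real.exp (-c * Real.sqrt (Real.log x)) := by
    refine IsBigO.of_bound |C| ?_
    filter_upwards [eventually_ge_atTop (2 : ℝ)] with x hx
    have hpos : 0 ≤ x * Real.exp (-c * Real.sqrt (Real.log x)) :=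
      mul_nonneg (by linarith) (Real.exp_pos _).le
    rw [Real.norm_eq_abs, Real.norm_eq_abs, abs_of_nonneg hpos]
    calc |(primeIdealCount K x : ℝ) - offsetLogIntegral x|
        ≤ C * x * Real.exp (-c * Real.sqrt (Real.log x)) := hC x hx
      _ = C * (x * Real.exp (-c * Real.sqrt (Real.log x))) := by ring
      _ ≤ |C| * (x * Real.exp (-c * Real.sqrt (Real.log x))) :=
          mul_le_mul_of_nonneg_right (le_abs_self C) hpos
  have ho : (fun x : ℝ ↦ (primeIdealCount K x : ℝ) - offsetLogIntegral x) =o[atTop]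
      fun x : ℝ ↦ x / Real.log x := hO.trans_isLittleO (isLittleO_mul_exp_neg_sqrt_log hc)
  exact ho.trans_isBigO isEquivalent_offsetLogIntegral_holds.symm.isBigO

/-- **`π_K(x) ∼ x / log x`** (Landau 1903). [cite: LandauMathAnn1903, Primidealsatz] -/
theorem isEquivalent_primeIdealCount (K : Type) [Field K] [NumberField K] :
    (fun x : ℝ ↦ (primeIdealCount K x : ℝ)) ~[atTop] fun x : ℝ ↦ x / Real.log x :=
  (isEquivalent_primeIdealCount_offsetLogIntegral K).trans isEquivalent_offsetLogIntegral_holds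

/-- `π_ℚ(x) ≠ 0` for `x ≥ 2`. [folklore] -/
theorem primeIdealCount_rat_ne_zero {x : ℝ} (hx : 2 ≤ x) : (primeIdealCount ℚ x : ℝ) ≠ 0 := by
  rw [primeIdealCount_rat (by linarith), Nat.cast_ne_zero, Ne, Nat.primeCounting_eq_zero_iff,
    not_le]
  have : (2 : ℕ) ≤ ⌊x⌋₊ := Nat.le_floor (by exact_mod_cast hx)
  omega

/-- **`π_K(x) / π_ℚ(x) → 1`**: a number field has asymptotically as many prime ideals of norm
`≤ x` as there are rational primes `≤ x` (both are `∼ Li(x)`). [cite: LandauMathAnn1903, Primidealsatz] -/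
theorem tendsto_primeIdealCount_div_primeIdealCount_rat (K : Type) [Field K] [NumberField K] :
    Tendsto (fun x : ℝ ↦ (primeIdealCount K x : ℝ) / primeIdealCount ℚ x) atTop (𝓝 1) := by
  have h := (isEquivalent_primeIdealCount K).trans (isEquivalent_primeIdealCount ℚ).symm
  have hz : ∀ᶠ x : ℝ in atTop, (primeIdealCount ℚ x : ℝ) ≠ 0 := by
    filter_upwards [eventually_ge_atTop (2 : ℝ)] with x hx using primeIdealCount_rat_ne_zero hx
  exact (isEquivalent_iff_tendsto_one hz).mp h

/-- **`π_K(n) / π(n) → 1`** over the natural numbers, with Mathlib's prime counting function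
`Nat.primeCounting` (`π_ℚ(n) = π(n)`, `primeIdealCount_rat`). [cite: LandauMathAnn1903, Primidealsatz] -/
theorem tendsto_primeIdealCount_div_primeCounting (K : Type) [Field K] [NumberField K] :
    Tendsto (fun n : ℕ ↦ (primeIdealCount K n : ℝ) / Nat.primeCounting n) atTop (𝓝 1) := by
  have h := (tendsto_primeIdealCount_div_primeIdealCount_rat K).comp tendsto_natCast_atTop_atTop
  refine h.congr fun n ↦ ?_
  simp only [Function.comp_apply]
  rw [primeIdealCount_rat (Nat.cast_nonneg n), Nat.floor_natCast]

end Literature.NumberTheory.LFunctions.NumberField
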